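import Summits.HodgeConjecture.CorCM.GaloisDicyclicAllTypes
import Summits.HodgeConjecture.CorCM.GaloisDicyclicTimesTwoNondegenerate
import HarnessLib

/-!
# Galois CM fields with Galois group `Q_{2^{k+2}} × C₂` (complex conjugation in the quaternion factor): EVERY abelian
# variety with complex multiplication by the field is STABLY NONDEGENERATE

COR-CM (cell `pub-hodgecm2`), binder seat b04 (gen 21), count-neutral claim DICYCLIC-ALLTYPES, part VI — the ALL-TYPES
upgrade of gen 20 part IX (`GaloisDicyclicTimesTwoNondegenerate`: every PRIMITIVE CM type of such a field is
nondegenerate), on the template of part III (`GaloisDicyclicAllTypes`).  KERNEL ONLY: theorems; no definition, no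
named fact, no `sorry`.  `HC_CM` is neither used nor claimed: this is the Hodge conjecture for a NAMED CLASS of abelian
varieties, UNCONDITIONALLY.

SETTING.  `G = Q_{2^{k+2}} × C₂ = QuaternionGroup n × Multiplicative (ZMod 2)`, `n = 2^k`, complex conjugation
`c = (aⁿ, 1)`.  An imprimitive CM type has a left stabiliser `v ≠ 1` with `c ∉ ⟨v⟩` (gen 20 part XIII; a stabiliser
subgroup never contains `c`).  GROUP THEORY (§1): the only such `v` are the two central involutions `(1, z)` and
`(aⁿ, z)` — every `a^j ≠ 1` has `aⁿ` among its powers (`⟨a⟩` is a cyclic `2`-group), and `(xa i, t)² = c` — and for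
both, `q ↦ [(q, 1)]` is an isomorphism `Q_{2^{k+2}} ≃ G ⧸ ⟨v⟩` (injective, equal cardinalities).  Hence (§2) the type
is induced from the fixed field `K₀ = F^{e⁻¹⟨v⟩}` (part I), a Galois CM field with `Gal(K₀/ℚ) ≃ Gal(F/ℚ) ⧸ e⁻¹⟨v⟩ ≃
G ⧸ ⟨v⟩ ≃ Q_{2^{k+2}}` (Mathlib `IsGalois.normalAutEquivQuotient`, `QuotientGroup.congr`), ALL of whose CM types are
nondegenerate (part IV `isNondegenerate_quaternion`), and lit-hodgefound's junction
`EndFieldFullDegree.isStablyNondegenerate_of_isNondegenerate` (`X ∼ B²`) finishes.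

* §1 `a_n_mem_zpowers_of_ne_one`, `eq_of_not_mem_zpowers` (the two admissible stabilisers), `normal_zpowers_of_comm`,
  `exists_mulEquiv_quotient_zpowers` (`Q ≃* G ⧸ ⟨v⟩`).
* §2 `isNondegenerate_or_exists_induced_quaternion_times_two` (type level) and **`isStablyNondegenerate_of_ringHom_
  quaternion_times_two`**: EVERY complex abelian variety `X` of dimension `4n = 2^{k+2}` with `φ : F →+* End⁰(X)` is
  stably nondegenerate; HC for all powers and everything isogenous to a power; realisation forms
  (`hodgeConjectureFor_pow_quaternion_times_two` = part IX's `…_of_isSimple_…` minus `IsSimple`); `HCOnClass` display.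

## References

* [Shimura1998] G. Shimura, *Abelian Varieties with Complex Multiplication and Modular Functions* (1998), §5.1 Prop. 3,
  §8.2 Prop. 26.
* [Gordon1999HodgeAVSurvey] B. B. Gordon, *A survey of the Hodge conjecture for abelian varieties*, Thm. 6.4, Def. 7.6.
* [Kubota1965] T. Kubota, Trans. AMS 118 (1965), §4 Lemma 2.
-/

noncomputable section

open CategoryTheory CategoryTheory.Limits NumberField

namespace Summit.HodgeConjecture.CorCM.GaloisDicyclic

open Literature.NumberTheory.ComplexMultiplication
open Literature.AlgebraicGeometry Literature.AlgebraicGeometry.Motives Literature.AlgebraicGeometry.HodgeTheory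
open Literature.AlgebraicGeometry.Motives.AbelianVariety
open Literature.AlgebraicGeometry.ComplexMultiplication
open Literature.AlgebraicGeometry.Pohlmann1968
open Summit.HodgeConjecture.CorCM.GaloisRank
open Summit.HodgeConjecture.HodgeConjecture.Ring2.ClassTargets
open QuaternionGroup

/-! ## §1 Group theory of `Q_{2^{k+2}} × C₂` -/

section Group

variable {n : ℕ} [NeZero n]

/-- **In `Q_{2^{k+2}}` (`n = 2^k`) every `a^j ≠ 1` has the central involution `aⁿ` among its powers** (`⟨a^j⟩` is a
non-trivial cyclic `2`-group; its element of order `2` is the unique involution `aⁿ`, gen 20 `eq_a_of_mul_self_eq_one`).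
[folklore] -/
theorem a_n_mem_zpowers_of_ne_one {k : ℕ} (hn : n = 2 ^ k) {j : ZMod (2 * n)} (hj : (a j : QuaternionGroup n) ≠ 1) :
    a n ∈ Subgroup.zpowers (a j : QuaternionGroup n) := by
  classical
  -- `orderOf (a j) = 2^s`, `s ≥ 1`
  have hdvd : orderOf (a j : QuaternionGroup n) ∣ 2 ^ (k + 2) := by
    have h := orderOf_dvd_card (G := QuaternionGroup n) (x := a j)
    have h4 : 4 * n = 2 ^ (k + 2) := by rw [hn]; ring
    rw [QuaternionGroup.card, h4] at h
    exact h
  obtain ⟨s, -, hs⟩ := (Nat.dvd_prime_pow Nat.prime_two).1 hdvd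
  have hs1 : s ≠ 0 := by
    rintro rfl
    rw [pow_zero, orderOf_eq_one_iff] at hs
    exact hj hs
  -- `u = (a j)^(2^(s-1))` is an involution, hence `aⁿ`
  set u : QuaternionGroup n := (a j) ^ (2 ^ (s - 1)) with hu_def
  have hu1 : u ≠ 1 := by
    refine pow_ne_one_of_lt_orderOf (by positivity) ?_
    rw [hs]
    exact Nat.pow_lt_pow_right (by norm_num) (by omega)
  have huu : u * u = 1 := by
    rw [hu_def, ← pow_add, ← two_mul, ← pow_succ', show s - 1 + 1 = s by omega, ← hs, pow_orderOf_eq_one]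
  rw [← eq_a_of_mul_self_eq_one u huu hu1]
  exact Subgroup.npow_mem_zpowers _ _

/-- The elements of `Multiplicative (ZMod 2)`. [folklore] -/
theorem eq_one_or_eq_ofAdd_one (t : Multiplicative (ZMod 2)) : t = 1 ∨ t = Multiplicative.ofAdd 1 := by
  have h : ∀ s : ZMod 2, s = 0 ∨ s = 1 := by decide
  rcases h (Multiplicative.toAdd t) with h0 | h1
  · exact Or.inl (by rw [← ofAdd_toAdd t, h0]; rfl)
  · exact Or.inr (by rw [← ofAdd_toAdd t, h1])

/-- **The admissible left stabilisers.**  In `G = Q_{2^{k+2}} × C₂` (`n = 2^k`) an element `v ≠ 1` whose cyclic group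
avoids `c = (aⁿ, 1)` is one of the two central involutions `(1, z)`, `(aⁿ, z)`. [folklore] -/
theorem eq_of_not_mem_zpowers {k : ℕ} (hn : n = 2 ^ k) {v : QuaternionGroup n × Multiplicative (ZMod 2)}
    (hv1 : v ≠ 1) (hcv : ((a n, 1) : QuaternionGroup n × Multiplicative (ZMod 2)) ∉ Subgroup.zpowers v) :
    v = (1, Multiplicative.ofAdd 1) ∨ v = (a n, Multiplicative.ofAdd 1) := by
  obtain ⟨q, t⟩ := v
  have hsq : ((q * q, 1) : QuaternionGroup n × Multiplicative (ZMod 2)) ∈ Subgroup.zpowers (q, t) := by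
    have h := Subgroup.npow_mem_zpowers ((q, t) : QuaternionGroup n × Multiplicative (ZMod 2)) 2
    rw [pow_two, Prod.mk_mul_mk] at h
    rcases eq_one_or_eq_ofAdd_one t with rfl | rfl
    · rwa [mul_one] at h
    · exact h
  rcases q with j | j
  · -- `q = a j`: `a(2j) = 1`, else `aⁿ ∈ ⟨(q², 1)⟩ ⊆ ⟨v⟩`
    have h2j : (a j : QuaternionGroup n) * a j = 1 := by
      by_contra hne
      apply hcv
      have hmem := a_n_mem_zpowers_of_ne_one hn (j := j + j) (by rwa [← a_mul_a])
      obtain ⟨m, hm⟩ := Subgroup.mem_zpowers_iff.1 hmem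
      have h' : ((a n, 1) : QuaternionGroup n × Multiplicative (ZMod 2)) = ((a j * a j, 1)) ^ m := by
        rw [Prod.pow_mk, one_zpow, a_mul_a, hm]
      rw [h']
      exact Subgroup.zpow_mem _ hsq m
    rcases eq_one_or_eq_of_mul_self (a j) h2j with h1 | hn'
    · -- `a j = 1`
      rcases eq_one_or_eq_ofAdd_one t with rfl | rfl
      · exact absurd (show ((a j, (1 : Multiplicative (ZMod 2))) : QuaternionGroup n × Multiplicative (ZMod 2)) = 1
          from Prod.ext h1 rfl) hv1
      · exact Or.inl (Prod.ext h1 rfl)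
    · rcases eq_one_or_eq_ofAdd_one t with rfl | rfl
      · exact absurd (by rw [hn']; exact Subgroup.mem_zpowers _) hcv
      · exact Or.inr (Prod.ext hn' rfl)
  · -- `q = xa j`: `q² = aⁿ`, so `c ∈ ⟨v⟩`
    exfalso
    apply hcv
    rwa [xa_mul_xa, show (n : ZMod (2 * n)) + j - j = n by ring] at hsq
where
  /-- `y² = 1` in `Dic_n` iff `y ∈ {1, aⁿ}`. [folklore] -/
  eq_one_or_eq_of_mul_self (y : QuaternionGroup n) (hy : y * y = 1) : y = 1 ∨ y = a n := by
    by_cases h : y = 1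
    · exact Or.inl h
    · exact Or.inr (eq_a_of_mul_self_eq_one y hy h)

/-- The cyclic group of a central element is normal. [folklore] -/
theorem normal_zpowers_of_comm {G : Type*} [Group G] (w : G) (hw : ∀ g : G, g * w = w * g) :
    (Subgroup.zpowers w).Normal := by
  refine ⟨fun x hx g => ?_⟩
  obtain ⟨m, rfl⟩ := Subgroup.mem_zpowers_iff.1 hx
  have hcw : Commute g w := hw g
  have hc : g * w ^ m = w ^ m * g := (hcw.zpow_right m).eq
  rw [hc, mul_inv_cancel_right]
  exact Subgroup.zpow_mem _ (Subgroup.mem_zpowers w) m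

omit [NeZero n] in
/-- Both admissible stabilisers are central involutions. [folklore] -/
theorem comm_and_mul_self_of_admissible {v : QuaternionGroup n × Multiplicative (ZMod 2)}
    (hv : v = (1, Multiplicative.ofAdd 1) ∨ v = (a n, Multiplicative.ofAdd 1)) :
    (∀ g, g * v = v * g) ∧ v * v = 1 ∧ v.2 = Multiplicative.ofAdd 1 := by
  have hz : Multiplicative.ofAdd (1 : ZMod 2) * Multiplicative.ofAdd (1 : ZMod 2) = 1 := by decide
  rcases hv with rfl | rfl
  · refine ⟨fun g => ?_, ?_, rfl⟩
    · obtain ⟨q, t⟩ := g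
      rw [Prod.mk_mul_mk, Prod.mk_mul_mk, mul_one, one_mul, mul_comm t]
    · rw [Prod.mk_mul_mk, mul_one, hz]; rfl
  · refine ⟨fun g => ?_, ?_, rfl⟩
    · obtain ⟨q, t⟩ := g
      rw [Prod.mk_mul_mk, Prod.mk_mul_mk, mul_comm t]
      congr 1
      rcases q with i | i
      · rw [a_mul_a, a_mul_a, add_comm]
      · rw [xa_mul_a, a_mul_xa]
        congr 1
        have h2n : (n : ZMod (2 * n)) + n = 0 := by
          rw [← two_mul]; exact_mod_cast ZMod.natCast_self (2 * n)
        linear_combination h2n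
    · rw [Prod.mk_mul_mk, a_mul_a, hz, show (n : ZMod (2 * n)) + n = 0 by
        rw [← two_mul]; exact_mod_cast ZMod.natCast_self (2 * n), ← one_def]
      rfl

/-- **`Q_{2^{k+2}} ≃ G ⧸ ⟨v⟩` for an admissible stabiliser `v`**: `q ↦ [(q, 1)]` is injective (`(q,1) ∈ ⟨v⟩ = {1, v}`
forces `q = 1` as `v.2 = z`) between groups of the same order `4n`. [folklore] -/
theorem exists_mulEquiv_quotient_zpowers {v : QuaternionGroup n × Multiplicative (ZMod 2)}
    (hv : v = (1, Multiplicative.ofAdd 1) ∨ v = (a n, Multiplicative.ofAdd 1)) :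
    ∃ _ : (Subgroup.zpowers v).Normal,
      Nonempty (QuaternionGroup n ≃* (QuaternionGroup n × Multiplicative (ZMod 2)) ⧸ Subgroup.zpowers v) := by
  classical
  obtain ⟨hcomm, hvv, hv2⟩ := comm_and_mul_self_of_admissible hv
  haveI hN : (Subgroup.zpowers v).Normal := normal_zpowers_of_comm v hcomm
  have hz1 : Multiplicative.ofAdd (1 : ZMod 2) ≠ 1 := by decide
  have hv1 : v ≠ 1 := fun h => by
    have h2 : v.2 = (1 : Multiplicative (ZMod 2)) := by rw [h]; rfl
    rw [hv2] at h2
    exact hz1 h2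
  have hord : orderOf v = 2 := orderOf_eq_prime (by rw [pow_two, hvv]) hv1
  -- the elements of `⟨v⟩` are `1` and `v`
  have hmem : ∀ w ∈ Subgroup.zpowers v, w = 1 ∨ w = v := fun w hw => by
    obtain ⟨m, rfl⟩ := Subgroup.mem_zpowers_iff.1 hw
    have h2 : v ^ (2 : ℤ) = 1 := by rw [zpow_two, hvv]
    rcases Int.even_or_odd m with ⟨i, hi⟩ | ⟨i, hi⟩
    · left; rw [hi, ← two_mul, zpow_mul, h2, one_zpow]
    · right; rw [hi, zpow_add, zpow_mul, h2, one_zpow, one_mul, zpow_one]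
  let ι : QuaternionGroup n →* (QuaternionGroup n × Multiplicative (ZMod 2)) ⧸ Subgroup.zpowers v :=
    (QuotientGroup.mk' (Subgroup.zpowers v)).comp (MonoidHom.inl _ _)
  have hι : Function.Injective ι := by
    rw [← MonoidHom.ker_eq_bot_iff, Subgroup.eq_bot_iff_forall]
    intro q hq
    rw [MonoidHom.mem_ker, MonoidHom.comp_apply, QuotientGroup.mk'_apply, QuotientGroup.eq_one_iff,
      MonoidHom.inl_apply] at hq
    rcases hmem _ hq with h | h
    · exact congrArg Prod.fst h
    · have h2 : (1 : Multiplicative (ZMod 2)) = v.2 := congrArg Prod.snd h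
      rw [hv2] at h2
      exact absurd h2.symm hz1
  have hcard : Nat.card (QuaternionGroup n) =
      Nat.card ((QuaternionGroup n × Multiplicative (ZMod 2)) ⧸ Subgroup.zpowers v) := by
    have h := Subgroup.card_eq_card_quotient_mul_card_subgroup (Subgroup.zpowers v)
    rw [Nat.card_zpowers, hord, Nat.card_prod, Nat.card_eq_fintype_card (α := Multiplicative (ZMod 2)),
      Fintype.card_multiplicative, ZMod.card] at h
    have hpos : 0 < Nat.card (QuaternionGroup n) := Nat.card_pos
    omega
  exact ⟨hN, ⟨MulEquiv.ofBijective ι ((Nat.bijective_iff_injective_and_card ι).2 ⟨hι, hcard⟩)⟩⟩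

end Group

/-! ## §2 Every abelian variety with an `F`-action is stably nondegenerate -/

section Field

variable {n : ℕ} [NeZero n]
variable {F : Type} [Field F] [NumberField F] [IsCMField F] [IsGalois ℚ F]

/-- **THE TYPE-LEVEL DICHOTOMY.**  `Gal(F/ℚ) ≅ Q_{2^{k+2}} × C₂`, `c = (aⁿ, 1)`: every CM type of `F` is nondegenerate
(part IX) or induced from a NONDEGENERATE CM type of a Galois CM subfield `K₀` with `Gal(K₀/ℚ) ≅ Q_{2^{k+2}}` (the fixed
field of `e⁻¹⟨v⟩`, `v ∈ {(1,z), (aⁿ,z)}`; parts I and IV). [cite: Shimura1998, §8.2 Prop. 26] [cite: Kubota1965, §4 Lemma 2] -/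
theorem isNondegenerate_or_exists_induced_quaternion_times_two {k : ℕ} (hn : n = 2 ^ k)
    (e : (F ≃ₐ[ℚ] F) ≃* QuaternionGroup n × Multiplicative (ZMod 2))
    (hc : e ((IsCMField.complexConj F).restrictScalars ℚ) = (a n, 1)) (Φ : CMType F) :
    IsNondegenerate Φ ∨
      ∃ (K₀ : IntermediateField ℚ F) (_ : IsCMField K₀) (_ : IsGalois ℚ K₀) (Φ₀ : CMType K₀),
        inducedCMType (algebraMap K₀ F) Φ₀ = Φ ∧ IsNondegenerate Φ₀ ∧
        Nonempty ((K₀ ≃ₐ[ℚ] K₀) ≃* QuaternionGroup n) := by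
  classical
  obtain ⟨φ₀⟩ := (inferInstance : Nonempty (F →+* ℂ))
  by_cases hprim : IsPrimitive (ℂ ≃+* ℂ) Φ.1 φ₀
  · exact Or.inl (isNondegenerate_of_isPrimitive_quaternion_times_two hn e hc φ₀ hprim)
  · right
    set S : Finset (QuaternionGroup n × Multiplicative (ZMod 2)) :=
      Finset.univ.filter fun y => embOf φ₀ (e.symm y) ∈ Φ.1 with hS_def
    have hS : ∀ y, y ∈ S ↔ embOf φ₀ (e.symm y) ∈ Φ.1 := fun y => by
      simp only [hS_def, Finset.mem_filter, Finset.mem_univ, true_and]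
    obtain ⟨v, hv1, hv⟩ := exists_leftStabiliser_of_not_isPrimitive e Φ φ₀ S hS hprim
    have hScm := model_mul_mem_iff e hc Φ φ₀ S hS
    have hcv : ((a n, 1) : QuaternionGroup n × Multiplicative (ZMod 2)) ∉ Subgroup.zpowers v := fun h =>
      iff_not_self ((mem_iff_mul_mem_of_mem_zpowers S hv h 1).trans (hScm 1))
    have hadm := eq_of_not_mem_zpowers hn hv1 hcv
    obtain ⟨hN, ⟨e₁⟩⟩ := exists_mulEquiv_quotient_zpowers hadm
    haveI := hN
    set H : Subgroup (F ≃ₐ[ℚ] F) := (Subgroup.zpowers v).comap (e : (F ≃ₐ[ℚ] F) →* _) with hH_def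
    haveI hHn : H.Normal := Subgroup.normal_comap _
    have hH : ∀ u ∈ H, e u ∈ Subgroup.zpowers v := fun u hu => Subgroup.mem_comap.1 hu
    have hcH : (IsCMField.complexConj F).restrictScalars ℚ ∉ H := fun h => hcv (hc ▸ hH _ h)
    haveI : IsCMField (IntermediateField.fixedField H) := isCMField_fixedField_of_not_mem H hcH
    have hG : IsGalois ℚ (IntermediateField.fixedField H) := IsGalois.of_fixedField_normal_subgroup H
    haveI := hG
    have he : H.map (e : (F ≃ₐ[ℚ] F) →* _) = Subgroup.zpowers v :=
      Subgroup.map_comap_eq_self_of_surjective e.surjective _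
    let e₀ : ((IntermediateField.fixedField H) ≃ₐ[ℚ] (IntermediateField.fixedField H)) ≃* QuaternionGroup n :=
      ((IsGalois.normalAutEquivQuotient H).symm.trans (QuotientGroup.congr H (Subgroup.zpowers v) e he)).trans e₁.symm
    obtain ⟨Φ₀, hΦ₀⟩ := exists_inducedCMType_fixedField_of_leftStabiliser e Φ φ₀ S hS hv H hH
    exact ⟨_, inferInstance, hG, Φ₀, hΦ₀, isNondegenerate_quaternion hn e₀ Φ₀, ⟨e₀⟩⟩

/-- **THEOREM (ALL TYPES).  `F` Galois CM with `Gal(F/ℚ) ≅ Q_{2^{k+2}} × C₂`, complex conjugation `(a^{2^k}, 1)`: EVERY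
complex abelian variety `X` of dimension `2^{k+2}` with `φ : F →+* End⁰(X)` — simple or not — is STABLY NONDEGENERATE.**
UNCONDITIONAL. [cite: Shimura1998, §5.1 Prop. 3, §8.2 Prop. 26] [cite: Gordon1999HodgeAVSurvey, Thm. 6.4 and Def. 7.6] -/
theorem isStablyNondegenerate_of_ringHom_quaternion_times_two {k : ℕ} (hn : n = 2 ^ k)
    (e : (F ≃ₐ[ℚ] F) ≃* QuaternionGroup n × Multiplicative (ZMod 2))
    (hc : e ((IsCMField.complexConj F).restrictScalars ℚ) = (a n, 1)) {X : AbelianVariety ℂ} (hXd : X.dim = 4 * n)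
    (φ : F →+* X.endAlgebra) : IsStablyNondegenerate X := by
  have hF : Module.finrank ℚ F = 2 * X.dim := by rw [finrank_eq_eight_mul e, hXd]; ring
  rcases isNondegenerate_or_exists_induced_quaternion_times_two hn e hc (cmTypeOfPair φ hF) with
    h | ⟨K₀, hK₀, -, Φ₀, hΦ, hΦ₀, -⟩
  · exact EndFieldFullDegree.isStablyNondegenerate_of_isNondegenerate_cmTypeOfPair φ hF h
  · haveI := hK₀
    exact EndFieldFullDegree.isStablyNondegenerate_of_isNondegenerate φ hF hΦ hΦ₀

/-- **The Hodge conjecture for everything isogenous to a power of such an `X`** — part IX's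
`hodgeConjectureFor_of_isIsogenous_powSucc_of_ringHom_quaternion_times_two` WITHOUT simplicity. UNCONDITIONAL.
[cite: Gordon1999HodgeAVSurvey, Thm. 6.3–6.4] [cite: vanGeemen1994HodgeAV, Lemma 3.7] -/
theorem hodgeConjectureFor_of_isIsogenous_powSucc_quaternion_times_two {k : ℕ} (hn : n = 2 ^ k)
    (e : (F ≃ₐ[ℚ] F) ≃* QuaternionGroup n × Multiplicative (ZMod 2))
    (hc : e ((IsCMField.complexConj F).restrictScalars ℚ) = (a n, 1)) {X : AbelianVariety ℂ} (hXd : X.dim = 4 * n)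
    (φ : F →+* X.endAlgebra) {B : AbelianVariety ℂ} {N : ℕ} (h : IsIsogenous B (X.powSucc N)) :
    HodgeConjectureFor B.dim B.X :=
  (isStablyNondegenerate_of_ringHom_quaternion_times_two hn e hc hXd φ).hodgeConjectureFor_of_isIsogenous_powSucc h

/-- The Hodge conjecture for every power `X^{N+1}`. [cite: Gordon1999HodgeAVSurvey, Thm. 6.4 and Def. 7.6] -/
theorem hodgeConjectureFor_powSucc_of_ringHom_quaternion_times_two {k : ℕ} (hn : n = 2 ^ k)
    (e : (F ≃ₐ[ℚ] F) ≃* QuaternionGroup n × Multiplicative (ZMod 2))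
    (hc : e ((IsCMField.complexConj F).restrictScalars ℚ) = (a n, 1)) {X : AbelianVariety ℂ} (hXd : X.dim = 4 * n)
    (φ : F →+* X.endAlgebra) (N : ℕ) : HodgeConjectureFor (X.powSucc N).dim (X.powSucc N).X :=
  (isStablyNondegenerate_of_ringHom_quaternion_times_two hn e hc hXd φ).hodgeConjectureFor_powSucc N

variable {Φ : CMType F} {A : AbelianVariety ℂ} {ι : 𝓞 F →+* End A} {θ : F →+* Module.End ℂ (complexBetti A.X 1)}

/-- **Realisation form**: every abelian variety `(A, ι)` of ANY CM type `(F; Φ)` is stably nondegenerate.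
[cite: Shimura1998, §5.1–5.2] [cite: Gordon1999HodgeAVSurvey, Thm. 6.4] -/
theorem isStablyNondegenerate_of_isCMTypeRealisation_quaternion_times_two {k : ℕ} (hn : n = 2 ^ k)
    (e : (F ≃ₐ[ℚ] F) ≃* QuaternionGroup n × Multiplicative (ZMod 2))
    (hc : e ((IsCMField.complexConj F).restrictScalars ℚ) = (a n, 1)) (hA : IsCMTypeRealisation Φ A ι θ) :
    IsStablyNondegenerate A := by
  obtain ⟨i, -⟩ := exists_ringHom_endAlgebra ι
  have hd : A.dim = 4 * n := by
    have h := finrank_eq_two_mul_dim_of_isCMTypeRealisation hA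
    rw [finrank_eq_eight_mul e] at h
    omega
  exact isStablyNondegenerate_of_ringHom_quaternion_times_two hn e hc hd i

/-- **THE HODGE CONJECTURE FOR EVERY POWER OF EVERY ABELIAN VARIETY WITH CM BY A GALOIS CM FIELD WITH GROUP
`Q_{2^{k+2}} × C₂`, complex conjugation in the quaternion factor** — part IX's
`hodgeConjectureFor_pow_of_isSimple_quaternion_times_two` without `A.IsSimple`. UNCONDITIONAL.
[cite: Gordon1999HodgeAVSurvey, Thm. 6.4] [cite: Shimura1998, §5.1 Prop. 3 and §8.2 Prop. 26] -/
theorem hodgeConjectureFor_pow_quaternion_times_two {k : ℕ} (hn : n = 2 ^ k)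
    (e : (F ≃ₐ[ℚ] F) ≃* QuaternionGroup n × Multiplicative (ZMod 2))
    (hc : e ((IsCMField.complexConj F).restrictScalars ℚ) = (a n, 1)) (hA : IsCMTypeRealisation Φ A ι θ) (N : ℕ) :
    HodgeConjectureFor (⨁ fun _ : Fin N => A).dim (⨁ fun _ : Fin N => A).X :=
  hodgeConjectureFor_of_isDivisorGenerated _
    ((isStablyNondegenerate_iff_forall_isDivisorGenerated_biproduct A).1
      (isStablyNondegenerate_of_isCMTypeRealisation_quaternion_times_two hn e hc hA) N)

end Field

/-! ## §3 Class-target display -/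

/-- **HC on the class «isogenous to a power of an abelian variety of dimension `2^{k+2}` with an action of a Galois CM
field `F`, `Gal(F/ℚ) ≅ Q_{2^{k+2}} × C₂`, complex conjugation `(a^{2^k}, 1)`»** — UNCONDITIONAL, NO simplicity (part IX's
`hcOnClass_isIsogenous_powSucc_simple_galoisCM_quaternion_times_two` strengthened). [cite: Gordon1999HodgeAVSurvey, Thm. 6.3–6.4] -/
theorem hcOnClass_isIsogenous_powSucc_galoisCM_quaternion_times_two :
    HCOnClass fun B ↦ ∃ (X : AbelianVariety ℂ) (N : ℕ) (F : Type) (_ : Field F) (_ : NumberField F)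
      (_ : IsCMField F) (_ : IsGalois ℚ F) (n k : ℕ) (_ : NeZero n)
      (e : (F ≃ₐ[ℚ] F) ≃* QuaternionGroup n × Multiplicative (ZMod 2)),
      n = 2 ^ k ∧ e ((IsCMField.complexConj F).restrictScalars ℚ) = (a n, 1) ∧ X.dim = 4 * n ∧
      Nonempty (F →+* X.endAlgebra) ∧ IsIsogenous B (X.powSucc N) := by
  rintro B ⟨X, N, F, _, _, _, _, n, k, _, e, hn, hc, hXd, ⟨φ⟩, h⟩
  exact hodgeConjectureFor_of_isIsogenous_powSucc_quaternion_times_two hn e hc hXd φ h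

end Summit.HodgeConjecture.CorCM.GaloisDicyclic

end
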